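import Summits.QuantumFields.YangMills.Theorems.BalabanUVNodesN15KingModelFullPropagatorByPartsLetters
import Summits.QuantumFields.YangMills.Theorems.BalabanUVNodesN15KingModelFullPropagatorBgNE2

/-!
# BalabanUVNodes ∕ N15 — THE KING-MODEL RUNG, PART Σ-d: THE JOINT -e∕-c KNIT — `T4EtaRate.NE2PlusOperator` BY NAME FOR KING's FULL `A = 0` PROPAGATOR DRESSED BY A
# LIVE FIRST-ORDER SCALAR BACKGROUND (`V = M_c + Σ_μ M_{a_μ}N∇_μ`, the linearised covariant-Laplacian species), ALL FOUR (3.42) ENTRIES CONSTRUCTED, ENTRY 2 BY PARTS,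
# size guard LIVE — dag-n15-c's `ne2PlusOperator_byParts` instantiated, every `U ≡ 1` letter a landed theorem of the rung
# (Track A, DAG node N15 = NE2; FAN-OUT v1.1 §N15 s3 «KING-MODEL ∕ RIEMANN-KERNEL RUNG»; the joint -e∕-c knit, knit half)

HONEST FRAMING.  Count-neutral KNIT (cell `pub-ymgap`, seat `pub-ymgap-dag-n15-e` g11; `--supports stmt-QuantumFields-20544 --as helper` = K3⁷
`SpineGivenEndpointR13SepCoPH`).  No new estimate.  dag-n15-c's FILE 7b `BackgroundLayer.ne2PlusOperator_byParts` proves `NE2PlusOperator` BY NAME for the FIRST-ORDER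
scalar species with ENTRY 2 BY PARTS (no mixed piece `∇G∇*`, which is log-divergent in sup currency for a full propagator) for ANY family whose only displayed hypotheses
are thirteen uniform `U ≡ 1` letters + the shift-defect row letter; their FILE 7c fired it on Bałaban's Landau-gauge `gOp` (`ne2PlusOperator_fullG_byParts`, a family with
size parameter `1`).  THIS FILE fires it on the rung's FULL multi-level propagator `A₀⁻¹ = (fineOp (L^K) M a_K (L^K)² m²)⁻¹` over the SIZED carrier (size letter `M` and
level count `K` = index data, so dag-n15-w2's liveness guard is met — §1): every letter is part Σ-a `kingFullProp_uniform_layer` (Ψ-e ∕ P″ ∕ Q4a ∕ Q4b), part Σ-c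
(`hasMaj_shiftT`, ★★ `hasMaj_shiftDefect_kingS` ⇐ W-b) or part Ψ-e again (coarse `D_μ`, fine `S_ν`, §2).
* §1 `bgKingInstanceBP`, `bgKingFamilyBP`, `bgKingInstanceBP_gf_M` ∕ `_gc_k` (guard = the datum), `exists_kingBgIdx_size_levels_ge_bp` (size AND level count cofinal).
* §2 `hasMaj_kingDOp_coarse`, `hasMaj_kingSOp_fine` (the two Ψ-e letters part Σ-a did not keep), ★ `kingFullProp_uniform_layer_byParts` (all the letters, ONE `(δ, β, m₀, c_T, m_T)`).
* §3 ★★ **`ne2PlusOperator_kingFullProp_byParts`** (`NE2PlusOperator c₃₅ (bgKingInstanceBP L γ) (bgKingFamilyBP L a γ)`, odd `L ≥ 3`, `a > 0`, `0 ≤ m₀²`, `0 < γ < 1`, every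
  `c₃₅ > 0`; `σ = δ∕12`, exponent `γ∕2`), `_dim4`.
WHAT IT SAYS.  For King's full propagator dressed by the by-parts first-order species — coefficient family `U = (c′, a′_μ)` in the (3.35)–(3.36) window of `coeffBgBP` (sup,
fibre-oscillation, gradient and shift letters, coarse partner = block averages), dressed pair `X′(U) = (1 − A₀′⁻¹V′)⁻¹A₀′⁻¹` vs `X(Ū)` — the four (3.42)-entry η-defects obey
`EtaRateIneq342` with ONE `(B₀, δ₀, γ∕2)` at every index and every regular `U`: NE2⁺'s operator layer with the «+» block live, in King's model, for the LINEARISED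
COVARIANT-LAPLACIAN-TYPE perturbation — the honest model of «what the curved case adds» at first order.
WHAT THE CURVED CASE STILL ADDS (one line): Bałaban's `G(U)` itself — non-abelian matrix coefficients `exp(iη ad A)` (n15-c M-files), the multiscale carrier with
`(L^jη)`-prefactors, the small-field window only LOCALLY after gauge fixing (B9 Sect. C) — NOT touched; NE2⁺ NOT PRINTED ∕ not proved; N15 NOT discharged; count-neutral;
nothing continuum ∕ ℝ⁴ ∕ OS ∕ mass-gap ∕ Clay.  0 `sorry`, standard axioms; plumbing `def`s only (§1).
Locators: [Balaban1985BackgroundPropagators] Thm 3.1 (3.42) p. 397 (quantifier template), (3.35)–(3.36) p. 396, (3.52) p. 400, (3.63)–(3.65) p. 402 (mechanism); [King1986]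
(2.13)–(2.17) p. 653, p. 664 (pairing), Prop. 3.8 (3.71) p. 664, Prop. 3.9 (3.73) p. 665; [Balaban1984PropagatorsI] Prop. 1.2 (1.110)–(1.111) p. 35 (shapes).
-/

noncomputable section

namespace Summit.QuantumFields.YangMills.BalabanUVNodes.N15KingModelRung.Curved

open Real Finset Matrix
open Literature.MathematicalPhysics.QuantumFieldTheory.Balaban1983to89
open Literature.MathematicalPhysics.QuantumFieldTheory.Balaban1983to89.B11SectG (BlockNorm HasMaj RowSum)
open Literature.MathematicalPhysics.QuantumFieldTheory.Balaban1983to89.T4EtaRate (PairedInstance NE2PlusOperator)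
open Literature.MathematicalPhysics.QuantumFieldTheory.Balaban1983to89.T4EtaRateDefect (idef rateWeight)
open Literature.MathematicalPhysics.QuantumFieldTheory.Balaban1983to89.T4EtaRateCoeffDefect (pull diagK FibreOsc blockAvg)
open Literature.MathematicalPhysics.QuantumFieldTheory.Balaban1983to89.B6Prop26Gluing (mulOp mulOp_apply)
open Literature.MathematicalPhysics.QuantumFieldTheory.Balaban1983to89.B5Prop11Plancherel (Tor fine unitVec)
open Literature.MathematicalPhysics.QuantumFieldTheory.Balaban1983to89.B6UnitTorusCarrier (unitTorusGeo unitTorusGeo_len triangle254_unitTorusGeo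
  rowSum_unitTorusGeo)
open Literature.MathematicalPhysics.QuantumFieldTheory.King1986 (aK)
open Literature.MathematicalPhysics.QuantumFieldTheory.King1986.Torus (fineOp blockOf tdistT tdistT_nonneg tdistT_self)
open Summit.QuantumFields.YangMills.BalabanUVNodes.N15.BackgroundLayer (sumJ fgradAdj coeffBgBP avg₁ bgInstanceBP bgFamilyBP ne2PlusOperator_byParts
  abs_blockAvg_le hasMaj_mulOp_translate hasMaj_mulOp_sub_translate pull_comp_mulOp_translate')
open Summit.QuantumFields.YangMills.BalabanUVNodes.N15.MatrixSpecies (liftBlk)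
open Summit.QuantumFields.YangMills.BalabanUVNodes.N15.VectorPiece (unitTorusGeoS unitTorusGeoS_M rateWeight_unitTorusGeoS)

variable {d : ℕ} (L : ℕ) [NeZero L]

/-! ## §1 The realised by-parts instance family of King's full propagator -/

section Data

variable {m0sq : ℝ}

/-- THE REALISED BY-PARTS INSTANCE at an index: dag-n15-c's `bgInstanceBP` over the SIZED unit-torus carrier of the cube `2L^e` with `K` levels, blocks `blockOf`, King's pairing
`underPtN`, the unit translations of both runs, spacings `L^K` ∕ `L^nL^K`, scale shift `n`, rate number `θ_i = (L^K)^{−γ∕2}`. [cite: Balaban1985BackgroundPropagators, Thm 3.14 pp.426–427 (typing template); (3.35)–(3.36) p.396; King1986, p.664 (pairing)] -/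
def bgKingInstanceBP (γ : ℝ) (i : KingBgIdx d m0sq) : PairedInstance :=
  bgInstanceBP (Fin (d + 1)) (g := unitTorusGeoS L i.K (EtaLatIdx.cube L i.toEtaLatIdx) i.Msz) (blockOf (L ^ i.K) (EtaLatIdx.cube L i.toEtaLatIdx))
    (underPtN L i.K i.n (EtaLatIdx.cube L i.toEtaLatIdx)) (fun μ => Equiv.addRight (unitVec (fine (L ^ i.K) (EtaLatIdx.cube L i.toEtaLatIdx)) μ))
    (fun μ => Equiv.addRight (unitVec (fine (L ^ i.n * L ^ i.K) (EtaLatIdx.cube L i.toEtaLatIdx)) μ)) ((L ^ i.K : ℕ) : ℝ) ((L ^ i.n * L ^ i.K : ℕ) : ℝ) i.n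
    (unitTorusGeoS_L_ne_zero' L i) (thetaK L γ i) (thetaK L γ i)

/-- THE REALISED BY-PARTS KERNEL FAMILY at an index: dag-n15-c's `bgFamilyBP` fed with the rung's operators — `G = A₀⁻¹`, `D₃ = N²ΔA₀⁻¹`, `D_μ = N∇_μA₀⁻¹` of the coarse run and their
fine-run twins (parts Σ-a `kingGOp` ∕ `kingLapOp` ∕ `kingDOp`; the source steps `A₀⁻¹∘fgradAdj` are built inside the device). [cite: Balaban1985BackgroundPropagators, (3.42) p.397, (3.63)–(3.65) p.402 (shapes, mechanism); King1986, (2.13) p.653] -/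
def bgKingFamilyBP (a γ : ℝ) (i : KingBgIdx d m0sq) : B9.KernelFamily (bgKingInstanceBP (d := d) L γ i).gc (bgKingInstanceBP (d := d) L γ i).Bf :=
  bgFamilyBP (J := Fin (d + 1)) (g := unitTorusGeoS L i.K (EtaLatIdx.cube L i.toEtaLatIdx) i.Msz) (blockOf (L ^ i.K) (EtaLatIdx.cube L i.toEtaLatIdx))
    (underPtN L i.K i.n (EtaLatIdx.cube L i.toEtaLatIdx)) (fun μ => Equiv.addRight (unitVec (fine (L ^ i.K) (EtaLatIdx.cube L i.toEtaLatIdx)) μ))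
    (fun μ => Equiv.addRight (unitVec (fine (L ^ i.n * L ^ i.K) (EtaLatIdx.cube L i.toEtaLatIdx)) μ)) ((L ^ i.K : ℕ) : ℝ) ((L ^ i.n * L ^ i.K : ℕ) : ℝ) i.n
    (unitTorusGeoS_L_ne_zero' L i) (thetaK L γ i) (thetaK L γ i) i.μ
    (kingGOp L a i.msq i.K (L ^ i.K) (EtaLatIdx.cube L i.toEtaLatIdx)) (kingLapOp L a i.msq i.K (L ^ i.K) (EtaLatIdx.cube L i.toEtaLatIdx))
    (fun μ => kingDOp L a i.msq i.K (L ^ i.K) (EtaLatIdx.cube L i.toEtaLatIdx) μ)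
    (kingGOp L a i.msq (i.K + i.n) (L ^ i.n * L ^ i.K) (EtaLatIdx.cube L i.toEtaLatIdx)) (kingLapOp L a i.msq (i.K + i.n) (L ^ i.n * L ^ i.K) (EtaLatIdx.cube L i.toEtaLatIdx))
    (fun μ => kingDOp L a i.msq (i.K + i.n) (L ^ i.n * L ^ i.K) (EtaLatIdx.cube L i.toEtaLatIdx) μ)

/-- **THE GUARD IS LIVE**: the fine realised instance's [B9] size parameter IS the index's `M`. [folklore] -/
theorem bgKingInstanceBP_gf_M (γ : ℝ) (i : KingBgIdx d m0sq) : (bgKingInstanceBP (d := d) L γ i).gf.M = i.Msz := rfl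

/-- … and the coarse instance's number of levels IS the index's `K`. [folklore] -/
theorem bgKingInstanceBP_gc_k (γ : ℝ) (i : KingBgIdx d m0sq) : (bgKingInstanceBP (d := d) L γ i).gc.k = i.K := rfl

/-- **NOT THE STATEMENT-LEVEL-VACUITY TRAP**: size parameter AND level count are COFINAL over the by-parts family (dag-n15-w2's `not_live_of_gf_M_lt` does not bite). [folklore] -/
theorem exists_kingBgIdx_size_levels_ge_bp (hm0 : 0 < m0sq) (γ R : ℝ) (k : ℕ) :
    ∃ i : KingBgIdx d m0sq, R ≤ (bgKingInstanceBP (d := d) L γ i).gf.M ∧ k ≤ (bgKingInstanceBP (d := d) L γ i).gc.k :=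
  ⟨⟨⟨0, max k 1, le_max_right _ _, 1, le_rfl, m0sq, hm0, le_rfl, max R 1, le_max_right _ _⟩, 0⟩, le_max_left _ _, le_max_left _ _⟩

end Data

/-! ## §2 The two remaining plain letters and the UNIFORM layer of the by-parts family -/

section Letters

/-- **PLAIN LETTER `D_μ = N∇_μA₀⁻¹`, COARSE RUN** (part Ψ-e `fullPropDOp_sup_decay` read through part Σ-a §1). [cite: Balaban1985BackgroundPropagators, Thm 3.1 (3.42) p.397 (second entry)] -/
theorem hasMaj_kingDOp_coarse (hLodd : Odd L) (hL : 2 ≤ L) {a : ℝ} (ha : 0 < a) {m0sq : ℝ} (hm0 : 0 ≤ m0sq) :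
    ∃ β δ : ℝ, 0 < β ∧ 0 < δ ∧ ∀ (K : ℕ), 1 ≤ K → ∀ (e : ℕ) (M : Fin (d + 1) → ℕ) [∀ μ, NeZero (M μ)], (∀ μ, M μ = 2 * L ^ e) →
      ∀ (msq : ℝ), 0 < msq → msq ≤ m0sq → ∀ (Msz : ℝ) (μ : Fin (d + 1)),
      HasMaj (BlockNorm.ofBlocks (unitTorusGeoS L K M Msz) (blockOf (L ^ K) M)) (BlockNorm.ofBlocks (unitTorusGeoS L K M Msz) (blockOf (L ^ K) M))
        (kingDOp L a msq K (L ^ K) M μ) (fun y y' => β * Real.exp (-(δ * tdistT M y y'))) := by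
  obtain ⟨C, δ, hC, hδ, H⟩ := fullPropDOp_sup_decay (d := d) L hLodd hL ha hm0
  refine ⟨C, δ, hC, hδ, fun K hK e M _ hM msq hmsq hcap Msz μ => ?_⟩
  refine hasMaj_ofBlocks_of_cubeBound L _ _ _ hC.le fun lam F D hF x hD => ?_
  rw [kingDOp_apply]
  exact H K hK (L ^ K) rfl e M hM msq hmsq hcap μ lam F D hF x hD

/-- **PLAIN LETTER `S_ν = A₀⁻¹N∇*_ν`, FINE RUN** (part Ψ-e `fullPropAdjOp_sup_decay` at `K + n` levels; fine blocks `blockOf ∘ π`). [cite: Balaban1985BackgroundPropagators, Thm 3.1 (3.42) p.397 (third entry)] -/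
theorem hasMaj_kingSOp_fine (hLodd : Odd L) (hL : 2 ≤ L) {a : ℝ} (ha : 0 < a) {m0sq : ℝ} (hm0 : 0 ≤ m0sq) :
    ∃ β δ : ℝ, 0 < β ∧ 0 < δ ∧ ∀ (K : ℕ), 1 ≤ K → ∀ (n e : ℕ) (M : Fin (d + 1) → ℕ) [∀ μ, NeZero (M μ)], (∀ μ, M μ = 2 * L ^ e) →
      ∀ (msq : ℝ), 0 < msq → msq ≤ m0sq → ∀ (Msz : ℝ) (ν : Fin (d + 1)),
      HasMaj (BlockNorm.ofBlocks (unitTorusGeoS L K M Msz) (blockOf (L ^ K) M ∘ underPtN L K n M))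
        (BlockNorm.ofBlocks (unitTorusGeoS L K M Msz) (blockOf (L ^ K) M ∘ underPtN L K n M))
        (kingSOp L a msq (K + n) (L ^ n * L ^ K) M ν) (fun y y' => β * Real.exp (-(δ * tdistT M y y'))) := by
  obtain ⟨C, δ, hC, hδ, H⟩ := fullPropAdjOp_sup_decay (d := d) L hLodd hL ha hm0
  refine ⟨C, δ, hC, hδ, fun K hK n e M _ hM msq hmsq hcap Msz ν => ?_⟩
  refine hasMaj_ofBlocks_of_cubeBound L _ _ _ hC.le fun lam F D hF x hD => ?_
  have hD' : ∀ y, lam y ≠ 0 → (D : ℝ) ≤ tdistT M (blockOf (L ^ n * L ^ K) M x) (blockOf (L ^ n * L ^ K) M y) := fun y hy => by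
    simpa only [Function.comp_apply, blockOf_underPtN] using hD y hy
  rw [kingSOp_apply]
  exact H (K + n) (by omega) (L ^ n * L ^ K) (by rw [pow_add, mul_comm]) e M hM msq hmsq hcap ν lam F D hF x hD'


/-- ★ **THE UNIFORM `U ≡ 1` LAYER OF THE BY-PARTS FAMILY AT KING's FULL PROPAGATOR** — the thirteen letters dag-n15-c's `ne2PlusOperator_byParts` displays, plus its shift-defect row
letter for every `Reg335`-regular coefficient family, at ONE `(δ, β, m₀, c_T, m_T)`: the plain majorants of `A₀⁻¹`, `N∇_μA₀⁻¹`, `A₀⁻¹N∇*_ν` (coarse), of `A₀′⁻¹`, `N′∇′_μA₀′⁻¹`,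
`N′²Δ′A₀′⁻¹`, `A₀′⁻¹N′∇′*_ν` (fine) (parts Ψ-e via Σ-a ∕ §2), the η-defects of the four kinds `≤ m₀(L^K)^{−γ∕2}e^{−δd}` (P″ ∕ Q4a ∕ Q4b via Σ-a), the shift costs `e^{δ}`
(Σ-c §3) and the row letter (Σ-c ★★ `hasMaj_shiftDefect_kingS` at `α = γ∕2`, with the carrier's sup and coarse-oscillation letters). [cite: Balaban1985BackgroundPropagators, Thm 3.1 (3.42)–(3.43) pp.397–398 (shape); King1986, (2.13)–(2.17) p.653, Prop. 3.8 (3.71) p.664, Prop. 3.9 (3.73) p.665] -/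
theorem kingFullProp_uniform_layer_byParts (hLodd : Odd L) (hL : 2 ≤ L) {a : ℝ} (ha : 0 < a) {m0sq : ℝ} (hm0 : 0 ≤ m0sq) {γ : ℝ} (hγ0 : 0 < γ) (hγ1 : γ < 1)
    (c35 : ℝ) :
    ∃ δ β m₀ cT mT : ℝ, 0 < δ ∧ 0 < β ∧ 0 < m₀ ∧ 0 < cT ∧ 0 < mT ∧ ∀ i : KingBgIdx d m0sq,
      HasMaj (BlockNorm.ofBlocks (unitTorusGeoS L i.K (EtaLatIdx.cube L i.toEtaLatIdx) i.Msz) (blockOf (L ^ i.K) (EtaLatIdx.cube L i.toEtaLatIdx))) (BlockNorm.ofBlocks (unitTorusGeoS L i.K (EtaLatIdx.cube L i.toEtaLatIdx) i.Msz) (blockOf (L ^ i.K) (EtaLatIdx.cube L i.toEtaLatIdx)))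
          (kingGOp L a i.msq i.K (L ^ i.K) (EtaLatIdx.cube L i.toEtaLatIdx))
          (fun y y' => β * Real.exp (-(δ * tdistT (EtaLatIdx.cube L i.toEtaLatIdx) y y'))) ∧
      (∀ μ, HasMaj (BlockNorm.ofBlocks (unitTorusGeoS L i.K (EtaLatIdx.cube L i.toEtaLatIdx) i.Msz) (blockOf (L ^ i.K) (EtaLatIdx.cube L i.toEtaLatIdx))) (BlockNorm.ofBlocks (unitTorusGeoS L i.K (EtaLatIdx.cube L i.toEtaLatIdx) i.Msz) (blockOf (L ^ i.K) (EtaLatIdx.cube L i.toEtaLatIdx)))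
          (kingDOp L a i.msq i.K (L ^ i.K) (EtaLatIdx.cube L i.toEtaLatIdx) μ)
          (fun y y' => β * Real.exp (-(δ * tdistT (EtaLatIdx.cube L i.toEtaLatIdx) y y')))) ∧
      HasMaj (BlockNorm.ofBlocks (unitTorusGeoS L i.K (EtaLatIdx.cube L i.toEtaLatIdx) i.Msz) (blockOf (L ^ i.K) (EtaLatIdx.cube L i.toEtaLatIdx) ∘ underPtN L i.K i.n (EtaLatIdx.cube L i.toEtaLatIdx))) (BlockNorm.ofBlocks (unitTorusGeoS L i.K (EtaLatIdx.cube L i.toEtaLatIdx) i.Msz) (blockOf (L ^ i.K) (EtaLatIdx.cube L i.toEtaLatIdx) ∘ underPtN L i.K i.n (EtaLatIdx.cube L i.toEtaLatIdx)))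
          (kingGOp L a i.msq (i.K + i.n) (L ^ i.n * L ^ i.K) (EtaLatIdx.cube L i.toEtaLatIdx))
          (fun y y' => β * Real.exp (-(δ * tdistT (EtaLatIdx.cube L i.toEtaLatIdx) y y'))) ∧
      (∀ μ, HasMaj (BlockNorm.ofBlocks (unitTorusGeoS L i.K (EtaLatIdx.cube L i.toEtaLatIdx) i.Msz) (blockOf (L ^ i.K) (EtaLatIdx.cube L i.toEtaLatIdx) ∘ underPtN L i.K i.n (EtaLatIdx.cube L i.toEtaLatIdx))) (BlockNorm.ofBlocks (unitTorusGeoS L i.K (EtaLatIdx.cube L i.toEtaLatIdx) i.Msz) (blockOf (L ^ i.K) (EtaLatIdx.cube L i.toEtaLatIdx) ∘ underPtN L i.K i.n (EtaLatIdx.cube L i.toEtaLatIdx)))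
          (kingDOp L a i.msq (i.K + i.n) (L ^ i.n * L ^ i.K) (EtaLatIdx.cube L i.toEtaLatIdx) μ)
          (fun y y' => β * Real.exp (-(δ * tdistT (EtaLatIdx.cube L i.toEtaLatIdx) y y')))) ∧
      HasMaj (BlockNorm.ofBlocks (unitTorusGeoS L i.K (EtaLatIdx.cube L i.toEtaLatIdx) i.Msz) (blockOf (L ^ i.K) (EtaLatIdx.cube L i.toEtaLatIdx) ∘ underPtN L i.K i.n (EtaLatIdx.cube L i.toEtaLatIdx))) (BlockNorm.ofBlocks (unitTorusGeoS L i.K (EtaLatIdx.cube L i.toEtaLatIdx) i.Msz) (blockOf (L ^ i.K) (EtaLatIdx.cube L i.toEtaLatIdx) ∘ underPtN L i.K i.n (EtaLatIdx.cube L i.toEtaLatIdx)))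
          (kingLapOp L a i.msq (i.K + i.n) (L ^ i.n * L ^ i.K) (EtaLatIdx.cube L i.toEtaLatIdx))
          (fun y y' => β * Real.exp (-(δ * tdistT (EtaLatIdx.cube L i.toEtaLatIdx) y y'))) ∧
      HasMaj (BlockNorm.ofBlocks (unitTorusGeoS L i.K (EtaLatIdx.cube L i.toEtaLatIdx) i.Msz) (blockOf (L ^ i.K) (EtaLatIdx.cube L i.toEtaLatIdx))) (BlockNorm.ofBlocks (unitTorusGeoS L i.K (EtaLatIdx.cube L i.toEtaLatIdx) i.Msz) (blockOf (L ^ i.K) (EtaLatIdx.cube L i.toEtaLatIdx) ∘ underPtN L i.K i.n (EtaLatIdx.cube L i.toEtaLatIdx)))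
          (idef (pull (underPtN L i.K i.n (EtaLatIdx.cube L i.toEtaLatIdx))) (pull (underPtN L i.K i.n (EtaLatIdx.cube L i.toEtaLatIdx))) (kingGOp L a i.msq (i.K + i.n) (L ^ i.n * L ^ i.K) (EtaLatIdx.cube L i.toEtaLatIdx)) (kingGOp L a i.msq i.K (L ^ i.K) (EtaLatIdx.cube L i.toEtaLatIdx)))
          (fun y y' => m₀ * ((L : ℝ) ^ i.K) ^ (-(γ / 2)) * Real.exp (-(δ * tdistT (EtaLatIdx.cube L i.toEtaLatIdx) y y'))) ∧
      (∀ μ, HasMaj (BlockNorm.ofBlocks (unitTorusGeoS L i.K (EtaLatIdx.cube L i.toEtaLatIdx) i.Msz) (blockOf (L ^ i.K) (EtaLatIdx.cube L i.toEtaLatIdx))) (BlockNorm.ofBlocks (unitTorusGeoS L i.K (EtaLatIdx.cube L i.toEtaLatIdx) i.Msz) (blockOf (L ^ i.K) (EtaLatIdx.cube L i.toEtaLatIdx) ∘ underPtN L i.K i.n (EtaLatIdx.cube L i.toEtaLatIdx)))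
          (idef (pull (underPtN L i.K i.n (EtaLatIdx.cube L i.toEtaLatIdx))) (pull (underPtN L i.K i.n (EtaLatIdx.cube L i.toEtaLatIdx))) (kingDOp L a i.msq (i.K + i.n) (L ^ i.n * L ^ i.K) (EtaLatIdx.cube L i.toEtaLatIdx) μ) (kingDOp L a i.msq i.K (L ^ i.K) (EtaLatIdx.cube L i.toEtaLatIdx) μ))
          (fun y y' => m₀ * ((L : ℝ) ^ i.K) ^ (-(γ / 2)) * Real.exp (-(δ * tdistT (EtaLatIdx.cube L i.toEtaLatIdx) y y')))) ∧
      HasMaj (BlockNorm.ofBlocks (unitTorusGeoS L i.K (EtaLatIdx.cube L i.toEtaLatIdx) i.Msz) (blockOf (L ^ i.K) (EtaLatIdx.cube L i.toEtaLatIdx))) (BlockNorm.ofBlocks (unitTorusGeoS L i.K (EtaLatIdx.cube L i.toEtaLatIdx) i.Msz) (blockOf (L ^ i.K) (EtaLatIdx.cube L i.toEtaLatIdx) ∘ underPtN L i.K i.n (EtaLatIdx.cube L i.toEtaLatIdx)))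
          (idef (pull (underPtN L i.K i.n (EtaLatIdx.cube L i.toEtaLatIdx))) (pull (underPtN L i.K i.n (EtaLatIdx.cube L i.toEtaLatIdx))) (kingLapOp L a i.msq (i.K + i.n) (L ^ i.n * L ^ i.K) (EtaLatIdx.cube L i.toEtaLatIdx)) (kingLapOp L a i.msq i.K (L ^ i.K) (EtaLatIdx.cube L i.toEtaLatIdx)))
          (fun y y' => m₀ * ((L : ℝ) ^ i.K) ^ (-(γ / 2)) * Real.exp (-(δ * tdistT (EtaLatIdx.cube L i.toEtaLatIdx) y y'))) ∧
      (∀ ν, HasMaj (BlockNorm.ofBlocks (unitTorusGeoS L i.K (EtaLatIdx.cube L i.toEtaLatIdx) i.Msz) (blockOf (L ^ i.K) (EtaLatIdx.cube L i.toEtaLatIdx))) (BlockNorm.ofBlocks (unitTorusGeoS L i.K (EtaLatIdx.cube L i.toEtaLatIdx) i.Msz) (blockOf (L ^ i.K) (EtaLatIdx.cube L i.toEtaLatIdx)))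
          ((kingGOp L a i.msq i.K (L ^ i.K) (EtaLatIdx.cube L i.toEtaLatIdx)) ∘ₗ fgradAdj ((L ^ i.K : ℕ) : ℝ) (Equiv.addRight (unitVec (fine (L ^ i.K) (EtaLatIdx.cube L i.toEtaLatIdx)) ν)))
          (fun y y' => β * Real.exp (-(δ * tdistT (EtaLatIdx.cube L i.toEtaLatIdx) y y')))) ∧
      (∀ ν, HasMaj (BlockNorm.ofBlocks (unitTorusGeoS L i.K (EtaLatIdx.cube L i.toEtaLatIdx) i.Msz) (blockOf (L ^ i.K) (EtaLatIdx.cube L i.toEtaLatIdx) ∘ underPtN L i.K i.n (EtaLatIdx.cube L i.toEtaLatIdx))) (BlockNorm.ofBlocks (unitTorusGeoS L i.K (EtaLatIdx.cube L i.toEtaLatIdx) i.Msz) (blockOf (L ^ i.K) (EtaLatIdx.cube L i.toEtaLatIdx) ∘ underPtN L i.K i.n (EtaLatIdx.cube L i.toEtaLatIdx)))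
          ((kingGOp L a i.msq (i.K + i.n) (L ^ i.n * L ^ i.K) (EtaLatIdx.cube L i.toEtaLatIdx)) ∘ₗ fgradAdj ((L ^ i.n * L ^ i.K : ℕ) : ℝ) (Equiv.addRight (unitVec (fine (L ^ i.n * L ^ i.K) (EtaLatIdx.cube L i.toEtaLatIdx)) ν)))
          (fun y y' => β * Real.exp (-(δ * tdistT (EtaLatIdx.cube L i.toEtaLatIdx) y y')))) ∧
      (∀ ν, HasMaj (BlockNorm.ofBlocks (unitTorusGeoS L i.K (EtaLatIdx.cube L i.toEtaLatIdx) i.Msz) (blockOf (L ^ i.K) (EtaLatIdx.cube L i.toEtaLatIdx))) (BlockNorm.ofBlocks (unitTorusGeoS L i.K (EtaLatIdx.cube L i.toEtaLatIdx) i.Msz) (blockOf (L ^ i.K) (EtaLatIdx.cube L i.toEtaLatIdx) ∘ underPtN L i.K i.n (EtaLatIdx.cube L i.toEtaLatIdx)))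
          (idef (pull (underPtN L i.K i.n (EtaLatIdx.cube L i.toEtaLatIdx))) (pull (underPtN L i.K i.n (EtaLatIdx.cube L i.toEtaLatIdx))) ((kingGOp L a i.msq (i.K + i.n) (L ^ i.n * L ^ i.K) (EtaLatIdx.cube L i.toEtaLatIdx)) ∘ₗ fgradAdj ((L ^ i.n * L ^ i.K : ℕ) : ℝ) (Equiv.addRight (unitVec (fine (L ^ i.n * L ^ i.K) (EtaLatIdx.cube L i.toEtaLatIdx)) ν))) ((kingGOp L a i.msq i.K (L ^ i.K) (EtaLatIdx.cube L i.toEtaLatIdx)) ∘ₗ fgradAdj ((L ^ i.K : ℕ) : ℝ) (Equiv.addRight (unitVec (fine (L ^ i.K) (EtaLatIdx.cube L i.toEtaLatIdx)) ν))))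
          (fun y y' => m₀ * ((L : ℝ) ^ i.K) ^ (-(γ / 2)) * Real.exp (-(δ * tdistT (EtaLatIdx.cube L i.toEtaLatIdx) y y')))) ∧
      (∀ μ, HasMaj (BlockNorm.ofBlocks (unitTorusGeoS L i.K (EtaLatIdx.cube L i.toEtaLatIdx) i.Msz) (blockOf (L ^ i.K) (EtaLatIdx.cube L i.toEtaLatIdx))) (BlockNorm.ofBlocks (unitTorusGeoS L i.K (EtaLatIdx.cube L i.toEtaLatIdx) i.Msz) (blockOf (L ^ i.K) (EtaLatIdx.cube L i.toEtaLatIdx)))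
          (pull ⇑(Equiv.addRight (unitVec (fine (L ^ i.K) (EtaLatIdx.cube L i.toEtaLatIdx)) μ)))
          (fun y y' => cT * Real.exp (-(δ * tdistT (EtaLatIdx.cube L i.toEtaLatIdx) y y')))) ∧
      (∀ μ, HasMaj (BlockNorm.ofBlocks (unitTorusGeoS L i.K (EtaLatIdx.cube L i.toEtaLatIdx) i.Msz) (blockOf (L ^ i.K) (EtaLatIdx.cube L i.toEtaLatIdx) ∘ underPtN L i.K i.n (EtaLatIdx.cube L i.toEtaLatIdx))) (BlockNorm.ofBlocks (unitTorusGeoS L i.K (EtaLatIdx.cube L i.toEtaLatIdx) i.Msz) (blockOf (L ^ i.K) (EtaLatIdx.cube L i.toEtaLatIdx) ∘ underPtN L i.K i.n (EtaLatIdx.cube L i.toEtaLatIdx)))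
          (pull ⇑(Equiv.addRight (unitVec (fine (L ^ i.n * L ^ i.K) (EtaLatIdx.cube L i.toEtaLatIdx)) μ)))
          (fun y y' => cT * Real.exp (-(δ * tdistT (EtaLatIdx.cube L i.toEtaLatIdx) y y')))) ∧
      (∀ (U : (Tor (fine (L ^ i.n * L ^ i.K) (EtaLatIdx.cube L i.toEtaLatIdx)) → ℝ) × (Fin (d + 1) → Tor (fine (L ^ i.n * L ^ i.K) (EtaLatIdx.cube L i.toEtaLatIdx)) → ℝ)) (α₀ : ℝ),
          (coeffBgBP (Fin (d + 1)) (underPtN L i.K i.n (EtaLatIdx.cube L i.toEtaLatIdx)) (fun μ => (Equiv.addRight (unitVec (fine (L ^ i.K) (EtaLatIdx.cube L i.toEtaLatIdx)) μ))) (fun μ => (Equiv.addRight (unitVec (fine (L ^ i.n * L ^ i.K) (EtaLatIdx.cube L i.toEtaLatIdx)) μ))) ((L ^ i.K : ℕ) : ℝ) ((L ^ i.n * L ^ i.K : ℕ) : ℝ) (unitTorusGeoS L i.K (EtaLatIdx.cube L i.toEtaLatIdx) i.Msz).M (thetaK L γ i)).Reg335 c35 α₀ U →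
        ∀ μ, HasMaj (BlockNorm.ofBlocks (unitTorusGeoS L i.K (EtaLatIdx.cube L i.toEtaLatIdx) i.Msz) (liftBlk (blockOf (L ^ i.K) (EtaLatIdx.cube L i.toEtaLatIdx)) (Fin (d + 1)))) (BlockNorm.ofBlocks (unitTorusGeoS L i.K (EtaLatIdx.cube L i.toEtaLatIdx) i.Msz) (blockOf (L ^ i.K) (EtaLatIdx.cube L i.toEtaLatIdx) ∘ underPtN L i.K i.n (EtaLatIdx.cube L i.toEtaLatIdx)))
          (idef (pull (underPtN L i.K i.n (EtaLatIdx.cube L i.toEtaLatIdx))) (pull (underPtN L i.K i.n (EtaLatIdx.cube L i.toEtaLatIdx))) (pull ⇑(Equiv.addRight (unitVec (fine (L ^ i.n * L ^ i.K) (EtaLatIdx.cube L i.toEtaLatIdx)) μ))) (pull ⇑(Equiv.addRight (unitVec (fine (L ^ i.K) (EtaLatIdx.cube L i.toEtaLatIdx)) μ))) ∘ₗ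
            (mulOp ((avg₁ (Fin (d + 1)) (underPtN L i.K i.n (EtaLatIdx.cube L i.toEtaLatIdx)) U).2 μ ∘ ⇑(Equiv.addRight (unitVec (fine (L ^ i.K) (EtaLatIdx.cube L i.toEtaLatIdx)) μ)).symm) ∘ₗ sumJ fun ν => ((kingGOp L a i.msq i.K (L ^ i.K) (EtaLatIdx.cube L i.toEtaLatIdx)) ∘ₗ fgradAdj ((L ^ i.K : ℕ) : ℝ) (Equiv.addRight (unitVec (fine (L ^ i.K) (EtaLatIdx.cube L i.toEtaLatIdx)) ν)))))
          (fun y y' => mT * (c35 * (unitTorusGeoS L i.K (EtaLatIdx.cube L i.toEtaLatIdx) i.Msz).M * α₀) * thetaK L γ i * Real.exp (-(δ * tdistT (EtaLatIdx.cube L i.toEtaLatIdx) y y')))) := by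
  obtain ⟨β₁, δ₁, m₁, hβ₁, hδ₁, hm₁, H⟩ := kingFullProp_uniform_layer (d := d) L hLodd hL ha hm0 hγ0.le hγ1
  obtain ⟨βD, δD, hβD, hδD, HD⟩ := hasMaj_kingDOp_coarse (d := d) L hLodd hL ha hm0
  obtain ⟨βS, δS, hβS, hδS, HS⟩ := hasMaj_kingSOp_fine (d := d) L hLodd hL ha hm0
  have hα0 : 0 < γ / 2 := half_pos hγ0
  have hα1 : γ / 2 < 1 := by linarith
  obtain ⟨δ₄, C₄, hδ₄, hC₄, H4⟩ := hasMaj_shiftDefect_kingS (d := d) L hLodd hL ha hm0 hα0 hα1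
  set δ : ℝ := min (min δ₁ δD) (min δS δ₄) with hδdef
  have hδ : 0 < δ := lt_min (lt_min hδ₁ hδD) (lt_min hδS hδ₄)
  obtain ⟨hd₁, hdD, hdS, hd₄⟩ : δ ≤ δ₁ ∧ δ ≤ δD ∧ δ ≤ δS ∧ δ ≤ δ₄ := by
    simp only [hδdef, min_le_iff, le_refl, true_or, or_true, and_self]
  set β : ℝ := max β₁ (max βD βS) with hβdef
  have hβ : 0 < β := lt_max_of_lt_left hβ₁
  obtain ⟨hb₁, hbD, hbS⟩ : β₁ ≤ β ∧ βD ≤ β ∧ βS ≤ β := by simp only [hβdef, le_max_iff, le_refl, true_or, or_true, and_self]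
  refine ⟨δ, β, m₁, Real.exp δ, 2 * C₄, hδ, hβ, hm₁, Real.exp_pos δ, by positivity, fun i => ?_⟩
  have hcube : ∀ μ, EtaLatIdx.cube L i.toEtaLatIdx μ = 2 * L ^ i.e := fun μ => rfl
  obtain ⟨hG, hG', hS₁, hD', hLap', hDG, hDD, hDS₁, hDLap⟩ := H i.K i.one_le_K i.n i.one_le_n i.e _ hcube i.msq i.msq_pos i.msq_le i.Msz i.μ
  have hθ : 0 ≤ ((L : ℝ) ^ i.K) ^ (-(γ / 2)) := Real.rpow_nonneg (pow_nonneg (Nat.cast_nonneg _) _) _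
  have hm₁θ : 0 ≤ m₁ * ((L : ℝ) ^ i.K) ^ (-(γ / 2)) := mul_nonneg hm₁.le hθ
  refine ⟨hasMaj_exp_weaken L hβ₁.le hb₁ hd₁ hG, fun μ => ?_, hasMaj_exp_weaken L hβ₁.le hb₁ hd₁ hG', fun μ => ?_, hasMaj_exp_weaken L hβ₁.le hb₁ hd₁ hLap',
    hasMaj_exp_weaken L hm₁θ le_rfl hd₁ hDG, fun μ => ?_, hasMaj_exp_weaken L hm₁θ le_rfl hd₁ hDLap, fun ν => ?_, fun ν => ?_, fun ν => ?_, fun μ => ?_, fun μ => ?_,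
    fun U α₀ hreg μ => ?_⟩
  · exact hasMaj_exp_weaken L hβD.le hbD hdD (HD i.K i.one_le_K i.e _ hcube i.msq i.msq_pos i.msq_le i.Msz μ)
  · exact hasMaj_exp_weaken L hβ₁.le hb₁ hd₁ (H i.K i.one_le_K i.n i.one_le_n i.e _ hcube i.msq i.msq_pos i.msq_le i.Msz μ).2.2.2.1
  · exact hasMaj_exp_weaken L hm₁θ le_rfl hd₁ (H i.K i.one_le_K i.n i.one_le_n i.e _ hcube i.msq i.msq_pos i.msq_le i.Msz μ).2.2.2.2.2.2.1
  · rw [kingGOp_comp_fgradAdj]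
    exact hasMaj_exp_weaken L hβ₁.le hb₁ hd₁ (H i.K i.one_le_K i.n i.one_le_n i.e _ hcube i.msq i.msq_pos i.msq_le i.Msz ν).2.2.1
  · rw [kingGOp_comp_fgradAdj]
    exact hasMaj_exp_weaken L hβS.le hbS hdS (HS i.K i.one_le_K i.n i.e _ hcube i.msq i.msq_pos i.msq_le i.Msz ν)
  · rw [kingGOp_comp_fgradAdj, kingGOp_comp_fgradAdj]
    exact hasMaj_exp_weaken L hm₁θ le_rfl hd₁ (H i.K i.one_le_K i.n i.one_le_n i.e _ hcube i.msq i.msq_pos i.msq_le i.Msz ν).2.2.2.2.2.2.2.1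
  · exact hasMaj_shiftT L i.K (L ^ i.K) _ i.Msz hδ.le μ
  · rw [blockOf_comp_underPtN]
    exact hasMaj_shiftT L i.K (L ^ i.n * L ^ i.K) _ i.Msz hδ.le μ
  · -- the shift-defect row letter: Σ-c ★★ with `C_a = M_{ā_μ∘e_μ⁻¹}`, `C_a⁺ = M_{ā_μ}`, `a₀ = c₃₅Mα₀`, `o₁ = c₃₅Mα₀θ_i`
    obtain ⟨⟨⟨hsc, hsa⟩, hoc, hoa⟩, hga, hga', hfaT, hfgT, hosc⟩ := hreg
    set r : ℝ := c35 * (unitTorusGeoS L i.K (EtaLatIdx.cube L i.toEtaLatIdx) i.Msz).M * α₀ with hrdef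
    have hr0 : 0 ≤ r := (abs_nonneg _).trans (hsc 0)
    have hrθ0 : 0 ≤ r * thetaK L γ i := mul_nonneg hr0 hθ
    have ha : ∀ μ' x, |(avg₁ (Fin (d + 1)) (underPtN L i.K i.n (EtaLatIdx.cube L i.toEtaLatIdx)) U).2 μ' x| ≤ r := fun μ' => abs_blockAvg_le _ hr0 (hsa μ')
    have hCa := hasMaj_mulOp_translate (g := unitTorusGeoS L i.K (EtaLatIdx.cube L i.toEtaLatIdx) i.Msz) (blockOf (L ^ i.K) (EtaLatIdx.cube L i.toEtaLatIdx)) (τ := fun μ => (Equiv.addRight (unitVec (fine (L ^ i.K) (EtaLatIdx.cube L i.toEtaLatIdx)) μ))) hr0 ha μ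
    have hOsc := hasMaj_mulOp_sub_translate (g := unitTorusGeoS L i.K (EtaLatIdx.cube L i.toEtaLatIdx) i.Msz) (blockOf (L ^ i.K) (EtaLatIdx.cube L i.toEtaLatIdx)) (τ := fun μ => (Equiv.addRight (unitVec (fine (L ^ i.K) (EtaLatIdx.cube L i.toEtaLatIdx)) μ)))
      (a := (avg₁ (Fin (d + 1)) (underPtN L i.K i.n (EtaLatIdx.cube L i.toEtaLatIdx)) U).2) μ hrθ0 (hosc μ)
    have hCaS := pull_comp_mulOp_translate' (τ := fun μ => (Equiv.addRight (unitVec (fine (L ^ i.K) (EtaLatIdx.cube L i.toEtaLatIdx)) μ))) (a := (avg₁ (Fin (d + 1)) (underPtN L i.K i.n (EtaLatIdx.cube L i.toEtaLatIdx)) U).2) μ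
    have key := H4 i.K i.one_le_K i.n i.e _ hcube i.msq i.msq_pos i.msq_le i.Msz μ _ _ r (r * thetaK L γ i) hr0 hrθ0 hCaS hCa hOsc
    refine key.mono fun y y' => ?_
    have hE : Real.exp (-(δ₄ * tdistT (EtaLatIdx.cube L i.toEtaLatIdx) y y')) ≤ Real.exp (-(δ * tdistT (EtaLatIdx.cube L i.toEtaLatIdx) y y')) :=
      Real.exp_le_exp.mpr (by nlinarith [tdistT_nonneg (EtaLatIdx.cube L i.toEtaLatIdx) y y'])
    have heq : C₄ * (r * thetaK L γ i + r * ((L : ℝ) ^ i.K) ^ (-(γ / 2))) = 2 * C₄ * r * thetaK L γ i := by rw [thetaK]; ring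
    calc C₄ * (r * thetaK L γ i + r * ((L : ℝ) ^ i.K) ^ (-(γ / 2))) * Real.exp (-(δ₄ * tdistT (EtaLatIdx.cube L i.toEtaLatIdx) y y'))
        ≤ C₄ * (r * thetaK L γ i + r * ((L : ℝ) ^ i.K) ^ (-(γ / 2))) * Real.exp (-(δ * tdistT (EtaLatIdx.cube L i.toEtaLatIdx) y y')) :=
          mul_le_mul_of_nonneg_left hE (by rw [thetaK]; positivity)
      _ = 2 * C₄ * (c35 * (unitTorusGeoS L i.K (EtaLatIdx.cube L i.toEtaLatIdx) i.Msz).M * α₀) * thetaK L γ i * Real.exp (-(δ * tdistT (EtaLatIdx.cube L i.toEtaLatIdx) y y')) := by rw [heq]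

end Letters

/-! ## §3 ★★ THE KNIT: `NE2PlusOperator` BY NAME for King's full propagator dressed by the by-parts FIRST-ORDER species -/

section Knit

/-- ★★ **NE2⁺, OPERATOR LAYER — `T4EtaRate.NE2PlusOperator` BY NAME FOR KING's FULL `A = 0` PROPAGATOR DRESSED BY A LIVE FIRST-ORDER SCALAR BACKGROUND, ALL FOUR (3.42)
ENTRIES CONSTRUCTED, ENTRY 2 BY PARTS**, on the realised family indexed by `KingBgIdx d m₀²` (size letter and level count = index data, cofinal: §1): the coefficient carrier's
(3.35)–(3.36) letters CONSUMED on every coefficient family `U = (c′, a′_μ)`, the size guard `M·α₀ ≤ a₀` LIVE, NO mixed piece `∇G∇*`, and EVERY `U ≡ 1` input a landed theorem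
of the rung (§2 `kingFullProp_uniform_layer_byParts`: Ψ-e ∕ P″ ∕ Q4a ∕ Q4b ∕ W-b).  dag-n15-c's FILE 7b `ne2PlusOperator_byParts` instantiated (`σ = δ∕12`, exponent `γ∕2`,
`J = Fin (d+1)`, shifts = unit translations, `∇*_ν = fgradAdj N (· + e_ν)`). [cite: Balaban1985BackgroundPropagators, Thm 3.1 p.397 (quantifier template); (3.35)–(3.36) p.396, (3.42) p.397, (3.52) p.400, (3.63)–(3.65) p.402 (shapes, mechanism); King1986, (2.13)–(2.17) p.653, Prop. 3.8 (3.71) p.664, Prop. 3.9 (3.73) p.665 (A = 0 model, rate factor)] -/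
theorem ne2PlusOperator_kingFullProp_byParts (hLodd : Odd L) (hL : 2 ≤ L) {a : ℝ} (ha : 0 < a) {m0sq : ℝ} (hm0 : 0 ≤ m0sq) {γ : ℝ} (hγ0 : 0 < γ)
    (hγ1 : γ < 1) (c35 : ℝ) (hc35 : 0 < c35) :
    NE2PlusOperator c35 (bgKingInstanceBP (d := d) (m0sq := m0sq) L γ) (bgKingFamilyBP (d := d) (m0sq := m0sq) L a γ) := by
  obtain ⟨δ, β, m₀, cT, mT, hδ, hβ, hm₀, hcT, hmT, H⟩ := kingFullProp_uniform_layer_byParts (d := d) L hLodd hL ha hm0 hγ0 hγ1 c35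
  have hL0 : L ≠ 0 := NeZero.ne L
  have hLr : (0 : ℝ) < (L : ℝ) := by exact_mod_cast Nat.pos_of_ne_zero hL0
  have hσ : 0 < δ / 12 := by positivity
  exact ne2PlusOperator_byParts (I := KingBgIdx d m0sq) (J := Fin (d + 1)) (fun i => unitTorusGeoS L i.K (EtaLatIdx.cube L i.toEtaLatIdx) i.Msz)
    (fun i => Tor (fine (L ^ i.K) (EtaLatIdx.cube L i.toEtaLatIdx))) (fun i => Tor (fine (L ^ i.n * L ^ i.K) (EtaLatIdx.cube L i.toEtaLatIdx)))
    (fun i => blockOf (L ^ i.K) (EtaLatIdx.cube L i.toEtaLatIdx)) (fun i => underPtN L i.K i.n (EtaLatIdx.cube L i.toEtaLatIdx))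
    (fun i μ => Equiv.addRight (unitVec (fine (L ^ i.K) (EtaLatIdx.cube L i.toEtaLatIdx)) μ)) (fun i μ => Equiv.addRight (unitVec (fine (L ^ i.n * L ^ i.K) (EtaLatIdx.cube L i.toEtaLatIdx)) μ))
    (fun i => ((L ^ i.K : ℕ) : ℝ)) (fun i => ((L ^ i.n * L ^ i.K : ℕ) : ℝ)) (fun i => i.n) (fun i => unitTorusGeoS_L_ne_zero' L i)
    (thetaK L γ) (thetaK L γ) (fun i => i.μ)
    (fun i => kingGOp L a i.msq i.K (L ^ i.K) (EtaLatIdx.cube L i.toEtaLatIdx)) (fun i => kingLapOp L a i.msq i.K (L ^ i.K) (EtaLatIdx.cube L i.toEtaLatIdx))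
    (fun i μ => kingDOp L a i.msq i.K (L ^ i.K) (EtaLatIdx.cube L i.toEtaLatIdx) μ)
    (fun i => kingGOp L a i.msq (i.K + i.n) (L ^ i.n * L ^ i.K) (EtaLatIdx.cube L i.toEtaLatIdx)) (fun i => kingLapOp L a i.msq (i.K + i.n) (L ^ i.n * L ^ i.K) (EtaLatIdx.cube L i.toEtaLatIdx))
    (fun i μ => kingDOp L a i.msq (i.K + i.n) (L ^ i.n * L ^ i.K) (EtaLatIdx.cube L i.toEtaLatIdx) μ)
    c35 hc35 (fun i => triangle254_unitTorusGeo L i.K _) (fun i a b => tdistT_nonneg _ _ _) (fun i y => tdistT_self _ y) hσ.le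
    (B4Sect5Proof.latticeConst_nonneg (d + 1) hσ.le) (fun i => rowSum_unitTorusGeo L i.K _ hσ)
    (fun i => inv_pos.mpr (pow_pos hLr _)) (fun i => hLr) (fun i y => (unitTorusGeo_len L i.K _ hL0 y).symm.le)
    (by linarith) hβ.le hm₀.le (half_pos hγ0) (fun i => Real.rpow_nonneg (pow_nonneg hLr.le _) _) (fun i y => le_rfl) hcT.le hmT.le
    (fun i => (H i).1) (fun i => (H i).2.1) (fun i => (H i).2.2.1) (fun i => (H i).2.2.2.1) (fun i => (H i).2.2.2.2.1) (fun i => (H i).2.2.2.2.2.1)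
    (fun i => (H i).2.2.2.2.2.2.1) (fun i => (H i).2.2.2.2.2.2.2.1) (fun i => (H i).2.2.2.2.2.2.2.2.1) (fun i => (H i).2.2.2.2.2.2.2.2.2.1)
    (fun i => (H i).2.2.2.2.2.2.2.2.2.2.1) (fun i => (H i).2.2.2.2.2.2.2.2.2.2.2.1) (fun i => (H i).2.2.2.2.2.2.2.2.2.2.2.2.1) (fun i => (H i).2.2.2.2.2.2.2.2.2.2.2.2.2)

/-- The four-dimensional instance (`d + 1 = 4`). [cite: Balaban1985BackgroundPropagators, Thm 3.1 p.397 (quantifier template)] -/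
theorem ne2PlusOperator_kingFullProp_byParts_dim4 (hLodd : Odd L) (hL : 2 ≤ L) {a : ℝ} (ha : 0 < a) {m0sq : ℝ} (hm0 : 0 ≤ m0sq) {γ : ℝ} (hγ0 : 0 < γ)
    (hγ1 : γ < 1) (c35 : ℝ) (hc35 : 0 < c35) :
    NE2PlusOperator c35 (bgKingInstanceBP (d := 3) (m0sq := m0sq) L γ) (bgKingFamilyBP (d := 3) (m0sq := m0sq) L a γ) :=
  ne2PlusOperator_kingFullProp_byParts (d := 3) L hLodd hL ha hm0 hγ0 hγ1 c35 hc35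

end Knit

end Summit.QuantumFields.YangMills.BalabanUVNodes.N15KingModelRung.Curved

end
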